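import Summits.CriticalPhenomena.PercolationContinuityZ3.Theorems.FK.InfiniteVolumeDLRMeasures
import Summits.CriticalPhenomena.PercolationContinuityZ3.Theorems.FK.InfiniteVolumeDLROneEdgeIff
import Literature.Probability.LatticeModels.GibbsTailConditioning
import Mathlib.Probability.ConditionalProbability
import HarnessLib

/-!
# FK-continuity transplant, FO-06/FO-10 (infinite-volume structure): the DLR equation against outside events,
# conditioning a DLR random-cluster measure on a tail event, and "extremal ⇒ tail-trivial" for `R_{p,q}`
# (Grimmett 2006, Def. (4.29)–(4.30) with Thm. (4.34)(c) / Prop. (4.37)(c); Georgii 2011, Thm. 7.7)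

Registered R87 (cell INBOX l.6278, 2026-08-24); registry row FO-10b-g408; label DPA-D (coordinator fk-4 g192).
Cell `fk-continuity` (bschramm), FO-10b lineage; support file for the FK-continuity transplant
(`--supports stmt-CriticalPhenomena-4575`); builds on p205010 (kernel theorem, internal audit signed; external expert
review pending). No named facts, no definitions, no sorries, standard axioms. Banked infinite-volume structure; not an
END-STATE dependency of the cell (not consumed by `_r3`); it says nothing about FH / TP_FK or continuity at `p_c`.

For `P ∈ R_{p,q}` (`IsDLRRandomCluster d p q P`, `0 ≤ p ≤ 1`, `q > 0`) and a finite region `Λ` with outside σ-algebra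
`𝒯_Λ = outsideEvents d Λ`:

* `IsDLRRandomCluster.setLIntegral_rcCondLaw_eq` — **the DLR equation integrated against an outside event**:
  `∫_B φ^ξ_{Λ,p,q}(A) P(dξ) = P(A ∩ B)` for EVERY measurable `A` and every `B ∈ 𝒯_Λ` (Def. (4.29)–(4.30); the tree's
  definition asks this for `B = Ω` only, and FO-10b-g407's `real_cylEvent_inter_eq_setIntegral` gives it for cylinders `A`);
* `IsDLRRandomCluster.cond` — **conditioning on an event lying in every `𝒯_Λ` preserves `R_{p,q}`**: `P(· | B) ∈ R_{p,q}`
  whenever `P(B) ≠ 0` (Georgii 2011, proof of Thm. 7.7: "conditioning `μ` on a tail event gives again a Gibbs measure";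
  the tree's `IsGibbsMeasure.cond` is the same statement for specifications indexed by finite coordinate sets);
  `IsDLRRandomCluster.cond_of_tailEvents` — in particular for every tail event `B` (`tailEvents (Sym2 (Site d)) Prop`);
* **`IsDLRRandomCluster.exists_tailEvents_decomposition_of_not_isTailTrivial`** — **extremal ⇒ tail-trivial, definition-free
  form**: a DLR random-cluster measure that is NOT tail-trivial is a non-trivial convex combination
  `P = P(B) P(·|B) + P(Bᶜ) P(·|Bᶜ)` of two DISTINCT members of `R_{p,q}` (Georgii 2011, Thm. 7.7 (a) ⇒ (b); the
  extremality notion itself is not introduced).  With FO-10b-g408's Prop. (4.37)(c)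
  (`InfiniteVolumeDLRPositiveAssociation.lean`) this is Grimmett's remark after Thm. (4.34): the extremal members of
  `R_{p,q}` are tail-trivial, hence positively associated (`q ≥ 1`).

## References

* G. Grimmett, *The Random-Cluster Model*, Springer 2006: Def. (4.29)–(4.30), Thm. (4.34)(c), Prop. (4.37)(c), and
  "tail-triviality is equivalent to extremality, see [134, Thm 7.7]", pp. 81–83, 86. [Grimmett2006]
* H.-O. Georgii, *Gibbs Measures and Phase Transitions*, 2nd ed., de Gruyter 2011, Thm. 7.7 and its proof. [Georgii2011]
-/

noncomputable section

open MeasureTheory ProbabilityTheory Filter Set Finset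

open scoped Topology ENNReal ProbabilityTheory

namespace Summit.CriticalPhenomena.PercolationContinuityZ3.Theorems.FK

open Literature.Probability.Percolation Literature.Probability.LatticeModels

variable {d : ℕ} {p q : ℝ} {P : Measure (BondConfig (Site d))}

namespace IsDLRRandomCluster

/-- **The DLR equation against an outside event** (Grimmett 2006, Def. (4.29)–(4.30)): for `P ∈ R_{p,q}`
(`0 ≤ p ≤ 1`, `q > 0`), a finite region `Λ`, EVERY measurable event `A` and every `B ∈ 𝒯_Λ`,
`∫_B φ^ξ_{Λ,p,q}(A) P(dξ) = P(A ∩ B)`.  Proof: `φ^ξ_Λ(A) = ∑_η φ^ξ_Λ(η) 1[η ∪ (ξ ∖ E_Λ) ∈ A]`, the events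
`{ξ : η ∪ (ξ ∖ E_Λ) ∈ A}` lie in `𝒯_Λ`, and on each of them intersected with `B` the cylinder form of (4.30)
(`real_cylEvent_inter_eq_setIntegral_of_lintegral_rcCondLaw_eq`) applies; on the cylinder `{ω ∩ E_Λ = η}` one has
`η ∪ (ω ∖ E_Λ) = ω`. [cite: Grimmett2006, Def. (4.29) eq. (4.30)] -/
theorem setLIntegral_rcCondLaw_eq (hP : IsDLRRandomCluster d p q P) (hp : p ∈ Set.Icc (0 : ℝ) 1) (hq : 0 < q)
    (Λ : Finset (Site d)) {A : Set (BondConfig (Site d))} (hA : MeasurableSet A) {B : Set (BondConfig (Site d))}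
    (hB : MeasurableSet[outsideEvents d Λ] B) :
    ∫⁻ ξ in B, rcCondLaw p q Λ ξ A ∂P = P (A ∩ B) := by
  classical
  haveI := hP.isProbabilityMeasure
  have hBm : MeasurableSet B := outsideEvents_le Λ _ hB
  set U := edgesIn (zdGraph d) Λ with hU
  set Hη : Finset (Sym2 (Site d)) → Set (BondConfig (Site d)) := fun η =>
    (fun ξ : BondConfig (Site d) => (↑η : Set (Sym2 (Site d))) ∪ (ξ \ ↑U)) ⁻¹' A with hHη
  have hHηo : ∀ η, MeasurableSet[outsideEvents d Λ] (Hη η) := fun η =>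
    measurableSet_outsideEvents_preimage_union_sdiff Λ η hA
  have hHηm : ∀ η, MeasurableSet (Hη η) := fun η => outsideEvents_le Λ _ (hHηo η)
  -- the law at `ξ`, evaluated on `A`, as a finite sum of kernel values times indicators
  have happly : ∀ ξ, rcCondLaw p q Λ ξ A =
      ∑ η ∈ U.powerset, (Hη η).indicator (fun ξ => ENNReal.ofReal (rcCondProb p q Λ ξ η)) ξ := by
    intro ξ
    rw [rcCondLaw_eq, Measure.finsetSum_apply]
    refine Finset.sum_congr rfl fun η _ => ?_
    rw [Measure.smul_apply, Measure.dirac_apply' _ hA, smul_eq_mul]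
    by_cases h : ((↑η : Set (Sym2 (Site d))) ∪ (ξ \ ↑U)) ∈ A
    · rw [Set.indicator_of_mem h, Set.indicator_of_mem (show ξ ∈ Hη η from h), Pi.one_apply, mul_one]
    · rw [Set.indicator_of_notMem h, Set.indicator_of_notMem (show ξ ∉ Hη η from h), mul_zero]
  simp_rw [happly]
  rw [lintegral_finsetSum _ fun η _ =>
    ((measurable_rcCondProb p q Λ η).ennreal_ofReal).indicator (hHηm η)]
  -- each term is `P(C_η ∩ H_η ∩ B) = P(C_η ∩ (A ∩ B))`
  have hterm : ∀ η ∈ U.powerset,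
      ∫⁻ ξ in B, (Hη η).indicator (fun ξ => ENNReal.ofReal (rcCondProb p q Λ ξ η)) ξ ∂P =
        P (cylEvent U η ∩ (A ∩ B)) := by
    intro η hη
    have hη' := Finset.mem_powerset.1 hη
    rw [lintegral_indicator (hHηm η), Measure.restrict_restrict (hHηm η),
      ← ofReal_integral_eq_lintegral_ofReal (integrable_rcCondProb P hp hq Λ hη').integrableOn
        (ae_of_all _ fun ξ => rcCondProb_nonneg hp hq Λ ξ η),
      ← real_cylEvent_inter_eq_setIntegral_of_lintegral_rcCondLaw_eq hp hq Λ
        (fun A hA => hP.lintegral_rcCondLaw_eq Λ hA) hη' ((hHηo η).inter hB), ofReal_measureReal]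
    congr 1
    ext ω
    simp only [Set.mem_inter_iff, hHη, Set.mem_preimage]
    constructor
    · rintro ⟨hC, hAω, hBω⟩
      rw [coe_union_sdiff_eq_self_of_mem_cylEvent hη' hC] at hAω
      exact ⟨hC, hAω, hBω⟩
    · rintro ⟨hC, hAω, hBω⟩
      rw [← coe_union_sdiff_eq_self_of_mem_cylEvent hη' hC] at hAω
      exact ⟨hC, hAω, hBω⟩
  rw [Finset.sum_congr rfl hterm, ← measure_eq_sum_measure_cylEvent_inter P U (hA.inter hBm)]

/-- **Conditioning on an event of every outside σ-algebra preserves `R_{p,q}`** (Georgii 2011, proof of Thm. 7.7,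
for the random-cluster specification): if `P ∈ R_{p,q}` (`0 ≤ p ≤ 1`, `q > 0`), `B ∈ 𝒯_Λ` for every finite region
`Λ`, and `P(B) ≠ 0`, then `P(· | B) ∈ R_{p,q}`: indeed `∫ φ^ξ_Λ(A) dP(·|B) = P(B)⁻¹ ∫_B φ^ξ_Λ(A) dP = P(A ∩ B)/P(B)`.
[cite: Georgii2011, Thm. 7.7 (proof); Grimmett2006, Def. (4.29)] -/
theorem cond (hP : IsDLRRandomCluster d p q P) (hp : p ∈ Set.Icc (0 : ℝ) 1) (hq : 0 < q)
    {B : Set (BondConfig (Site d))} (hB : ∀ Λ : Finset (Site d), MeasurableSet[outsideEvents d Λ] B)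
    (hPB : P B ≠ 0) : IsDLRRandomCluster d p q (P[|B]) := by
  haveI := hP.isProbabilityMeasure
  have hBm : MeasurableSet B := outsideEvents_le ∅ _ (hB ∅)
  refine ⟨cond_isProbabilityMeasure hPB, fun Λ A hA => ?_⟩
  rw [ProbabilityTheory.cond, lintegral_smul_measure, hP.setLIntegral_rcCondLaw_eq hp hq Λ hA (hB Λ),
    Measure.smul_apply, Measure.restrict_apply hA, smul_eq_mul]

/-- **Conditioning on a tail event preserves `R_{p,q}`**: for `P ∈ R_{p,q}` (`0 ≤ p ≤ 1`, `q > 0`) and a tail event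
`B` (`tailEvents (Sym2 (Site d)) Prop`) of positive probability, `P(· | B) ∈ R_{p,q}` — a tail event lies in every
`𝒯_Λ = 𝓕_{(E_Λ)ᶜ}`. [cite: Georgii2011, Thm. 7.7 (proof)] -/
theorem cond_of_tailEvents (hP : IsDLRRandomCluster d p q P) (hp : p ∈ Set.Icc (0 : ℝ) 1) (hq : 0 < q)
    {B : Set (BondConfig (Site d))} (hB : MeasurableSet[tailEvents (Sym2 (Site d)) Prop] B) (hPB : P B ≠ 0) :
    IsDLRRandomCluster d p q (P[|B]) :=
  hP.cond hp hq (fun Λ => tailEvents_le_cylinderEvents (V := Sym2 (Site d)) (S := Prop) (edgesIn (zdGraph d) Λ) _ hB)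
    hPB

/-- **Extremal members of `R_{p,q}` are tail-trivial (definition-free form)** (Georgii 2011, Thm. 7.7, (a) ⇒ (b);
Grimmett 2006, remark in the proof of Thm. (4.34)(c)): if `P ∈ R_{p,q}` (`0 ≤ p ≤ 1`, `q > 0`) is NOT tail-trivial,
then there is a tail event `B` with `0 < P(B) < 1`, both `P(·|B)` and `P(·|Bᶜ)` belong to `R_{p,q}`, they are
distinct, and `P = P(B) P(·|B) + P(Bᶜ) P(·|Bᶜ)` — so `P` is not an extreme point of the convex set `R_{p,q}`.
[cite: Georgii2011, Thm. 7.7] -/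
theorem exists_tailEvents_decomposition_of_not_isTailTrivial (hP : IsDLRRandomCluster d p q P)
    (hp : p ∈ Set.Icc (0 : ℝ) 1) (hq : 0 < q) (h : ¬ IsTailTrivial (V := Sym2 (Site d)) (S := Prop) P) :
    ∃ B : Set (BondConfig (Site d)), MeasurableSet[tailEvents (Sym2 (Site d)) Prop] B ∧ 0 < P B ∧ P B < 1 ∧
      IsDLRRandomCluster d p q (P[|B]) ∧ IsDLRRandomCluster d p q (P[|Bᶜ]) ∧ P[|B] ≠ P[|Bᶜ] ∧
      P B • P[|B] + P Bᶜ • P[|Bᶜ] = P := by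
  haveI := hP.isProbabilityMeasure
  obtain ⟨B, hBt, hB0, hB1⟩ : ∃ B : Set (BondConfig (Site d)),
      MeasurableSet[tailEvents (Sym2 (Site d)) Prop] B ∧ P B ≠ 0 ∧ P B ≠ 1 := by
    by_contra hne
    refine h fun B hB => ?_
    by_contra hB'
    exact hne ⟨B, hB, fun h0 => hB' (Or.inl h0), fun h1 => hB' (Or.inr h1)⟩
  have hBm : MeasurableSet B := MeasurableSet.of_tailEvents hBt
  have hBc0 : P Bᶜ ≠ 0 := fun h0 => hB1 ((prob_compl_eq_zero_iff hBm).1 h0)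
  have hBct : MeasurableSet[tailEvents (Sym2 (Site d)) Prop] Bᶜ := hBt.compl
  refine ⟨B, hBt, pos_iff_ne_zero.2 hB0, lt_of_le_of_ne prob_le_one hB1, hP.cond_of_tailEvents hp hq hBt hB0,
    hP.cond_of_tailEvents hp hq hBct hBc0, fun heq => ?_, measure_smul_cond_add_compl P hBm⟩
  -- `P(B | B) = 1` but `P(B | Bᶜ) = 0`
  have h1 : (P[|B]) B = 1 := by
    rw [cond_apply hBm, Set.inter_self, ENNReal.inv_mul_cancel hB0 (measure_ne_top _ _)]
  have h2 : (P[|Bᶜ]) B = 0 := by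
    rw [cond_apply hBm.compl, Set.compl_inter_self, measure_empty, mul_zero]
  rw [heq, h2] at h1
  exact zero_ne_one h1

end IsDLRRandomCluster

end Summit.CriticalPhenomena.PercolationContinuityZ3.Theorems.FK

end
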